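import Mathlib
import Literature.MathematicalPhysics.AQFT.OffDiagonalFlatDecay
import Summits.QuantumFields.YangMills.Theorems.NPointIsotropy.Negative.NPointRegularJunk
import Summits.QuantumFields.YangMills.Theorems.MirrorModularBoostsCurvatureBoostCovarianceDominatedTieLimitRiemannSum
import HarnessLib

/-!
# An `L¹(w)`-dominated functional on `⁰𝒮` is a function — stub `stub_regular_of_dominated`

Line `boosts-inherit-mirrors` of crux `MirrorModularBoosts.CurvatureBoostCovariance`
(stmt-QuantumFields-9663), Stub 1c of reshape 8 of the registered skeleton
`Cruxes/CurvatureBoostCovariance/Lines/boosts_inherit_mirrors.lean` (model-blind analysis; Step 0 of the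
line, `NPointRegular`, is derived in the skeleton from Stub 1a — tempered lattice densities tied to the
Schwinger functions — via Stub 1b `stub_dominatedTieLimit` and this stub).

Statement (`stub_regular_of_dominated`, registered signature verbatim).  On `X = (ℝ⁴)ⁿ` let `T` be a
continuous linear functional on `𝓢(X, ℂ)` and `w ≥ 0` a measurable weight, tempered off the
coincidence locus `A = {∃ i ≠ j, yᵢ = yⱼ}`: `w y ≤ C (1 + ‖y‖)^N (1 + Σ_i Σ_{j ≠ i} ‖yᵢ - yⱼ‖⁻¹)^N`,
and suppose the DOMINATION `‖T F‖ ≤ ∫ ‖F‖ w` for every `F ∈ ⁰𝒮` (`IsOffDiagonal`: flat on `A`).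
Then there is `W : X → ℂ` with `W · F ∈ L¹` and `T F = ∫ W · F` for every `F ∈ ⁰𝒮`.

Proof (Hilbert space: Cauchy–Schwarz + Hahn–Banach + Riesz; no Riesz–Markov, no density theorem).
Put `m = 2n + 1` and, for `F ∈ ⁰𝒮`, `φ_F(y) = w(y) (1 + ‖y‖)^m F(y)`.
1. *Flat decay against the pair weight* (`RegularOfDominated.flat_decay_pairWeight`,
   `norm_mul_weight_le`; adapted from the file of Stub 1b
   `Theorems/MirrorModularBoostsCurvatureBoostCovarianceDominatedTieLimit.lean`, so that this file does
   not depend on that module's hub build, with the Schwartz norm `|F|_{α+β+1}` of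
   `Literature/MathematicalPhysics/AQFT/OffDiagonalFlatDecay` as the constant):
   `(1 + ‖y‖)^α ‖F y‖ (1 + Σ_i Σ_{j≠i} ‖yᵢ - yⱼ‖⁻¹)^β ≤ 4^α (1 + n²)^β |F|_{α+β+1}` — plain Schwartz
   decay if all inverse pair distances are `≤ 1`, otherwise the pair with the largest inverse distance
   `ρ > 1` bounds the double sum by `n² ρ` and the weighted flatness bound
   `IsOffDiagonal.one_add_norm_pow_mul_norm_le_sub` (Taylor at the coincident point `y_j ↦ y_i`)
   supplies `ρ^{-(β+1)}`.  Hence `‖F y‖ w y ≤ K_F (1 + ‖y‖)^{-M}` for every `M`.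
2. `φ_F ∈ L²(X)` (`memLp_two_weighted`): `‖φ_F(y)‖ ≤ K_F (1 + ‖y‖)^{-m}` (step 1 with `M = 2m`) and
   `(1 + ‖y‖)^{-2m} ∈ L¹` as `2m = 4n + 2 > 4n = dim X` (`DominatedTieLimit.integrable_piMajorant`).
3. Cauchy–Schwarz (`integral_norm_mul_weight_le`): `∫ ‖F‖ w = ⟪‖φ_F‖, (1 + ‖·‖)^{-m}⟫_{L²(X, ℝ)}
   ≤ ‖φ_F‖₂ K`, `K = ‖(1 + ‖·‖)^{-m}‖₂`; so `‖T F‖ ≤ K ‖J F‖₂` on the `ℂ`-subspace `⁰𝒮`, where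
   `J : F ↦ [φ_F]` is `ℂ`-linear `⁰𝒮 → L²(X, ℂ)`.
4. Abstract representation (`exists_inner_repr_of_norm_le`): a linear functional `T` on a complex vector
   space `V` with `‖T v‖ ≤ K ‖J v‖`, `J : V → H` linear into a Hilbert space, is `T v = ⟪ξ, J v⟫` for
   some `ξ ∈ H`: `ker J ≤ ker T`, so `T` factors through a functional on `range J` bounded by `K ‖·‖`
   (`LinearMap.quotKerEquivRange`, `LinearMap.mkContinuous`), extended to `H` by Hahn–Banach
   (`exists_extension_norm_eq`) and represented by Riesz (`InnerProductSpace.toDual`).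
5. `T F = ⟪ξ, J F⟫ = ∫ conj ξ · φ_F = ∫ W · F` with `W = conj ξ · w (1 + ‖·‖)^m`, and
   `W · F = conj ξ · φ_F ∈ L¹` as a product of two `L²` functions (`MeasureTheory.L2.integrable_inner`).
   The degenerate case `n = 0` (`X` a point) is covered by the same argument.

References: K. Osterwalder, R. Schrader, Comm. Math. Phys. 31 (1973) §2 and 42 (1975) §2 (the space
`⁰𝒮`, temperedness estimates); representing a dominated functional by Cauchy–Schwarz + Riesz is
folklore (von Neumann's Hilbert-space proof of the Radon–Nikodym theorem). [folklore]
-/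

noncomputable section

namespace Summit.QuantumFields.YangMills.Theorems.CurvatureBoostCovariance.BoostsInheritMirrors

open scoped BigOperators SchwartzMap InnerProductSpace ComplexConjugate ENNReal
open MeasureTheory Filter Topology
open Literature.MathematicalPhysics.QuantumLattice Literature.MathematicalPhysics.AQFT
open Summit.QuantumFields.YangMills.Theorems.NPointIsotropy.Negative (E4)

namespace RegularOfDominated

/-! ## Abstract representation of norm-dominated functionals -/

/-- **A functional dominated by the norm of a linear map into a Hilbert space is represented by a
vector.** If `T : V → ℂ` and `J : V → H` are `ℂ`-linear, `H` is a complex Hilbert space and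
`‖T v‖ ≤ K ‖J v‖` for all `v`, then `T v = ⟪ξ, J v⟫` for some `ξ ∈ H` (factor through `range J`,
extend by Hahn–Banach, represent by Riesz). [folklore] -/
theorem exists_inner_repr_of_norm_le {V H : Type*} [AddCommGroup V] [Module ℂ V]
    [NormedAddCommGroup H] [InnerProductSpace ℂ H] [CompleteSpace H]
    (T : V →ₗ[ℂ] ℂ) (J : V →ₗ[ℂ] H) (K : ℝ) (h : ∀ v, ‖T v‖ ≤ K * ‖J v‖) :
    ∃ ξ : H, ∀ v, T v = ⟪ξ, J v⟫_ℂ := by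
  have hker : LinearMap.ker J ≤ LinearMap.ker T := by
    intro v hv
    rw [LinearMap.mem_ker] at hv ⊢
    have h' := h v
    rw [hv, norm_zero, mul_zero] at h'
    exact norm_le_zero_iff.1 h'
  set f₀ : LinearMap.range J →ₗ[ℂ] ℂ :=
    (LinearMap.ker J).liftQ T hker ∘ₗ J.quotKerEquivRange.symm.toLinearMap with hf₀def
  have hf₀ : ∀ v, f₀ ⟨J v, LinearMap.mem_range_self J v⟩ = T v := by
    intro v
    simp [hf₀def, LinearMap.quotKerEquivRange_symm_apply_image]
  have hbound : ∀ x : LinearMap.range J, ‖f₀ x‖ ≤ K * ‖x‖ := by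
    rintro ⟨x, v, rfl⟩
    rw [hf₀]
    exact h v
  obtain ⟨g, hg, -⟩ := exists_extension_norm_eq (LinearMap.range J) (f₀.mkContinuous K hbound)
  refine ⟨(InnerProductSpace.toDual ℂ H).symm g, fun v => ?_⟩
  rw [InnerProductSpace.toDual_symm_apply]
  have h' := hg ⟨J v, LinearMap.mem_range_self J v⟩
  rw [LinearMap.mkContinuous_apply, hf₀] at h'
  exact h'.symm

/-! ## Flat decay of `⁰𝒮` functions against tempered pair weights -/

section Flat

variable {E : Type*} [NormedAddCommGroup E] [NormedSpace ℝ E] {n : ℕ}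

-- adapted from `DominatedTieLimit.flat_decay_pairWeight`
-- (`Theorems/MirrorModularBoostsCurvatureBoostCovarianceDominatedTieLimit.lean`), with the Schwartz norm
-- `|F|_{α+β+1}` and the Literature flatness bound `IsOffDiagonal.one_add_norm_pow_mul_norm_le_sub`.
/-- **Flat decay against the pair weight.** For `F ∈ ⁰𝒮(Eⁿ)` and all `α β : ℕ`, `y : Eⁿ`:
`(1 + ‖y‖)^α ‖F y‖ (1 + Σ_i Σ_{j ≠ i} ‖y_i - y_j‖⁻¹)^β ≤ 4^α (1 + n²)^β |F|_{α+β+1}`.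
If all inverse pair distances are `≤ 1` this is plain Schwartz decay; otherwise the pair `(i, j)`
with the largest inverse distance `ρ > 1` controls the double sum by `n² ρ`, and the weighted
flatness bound at the coincident point `y` with `y_j ↦ y_i` (at sup-distance `ρ⁻¹ ≤ 1`) gives the
factor `ρ^{-(β+1)}`. [folklore] -/
theorem flat_decay_pairWeight {F : 𝓢((Fin n → E), ℂ)} (hF : IsOffDiagonal F) (α β : ℕ)
    (y : Fin n → E) :
    (1 + ‖y‖) ^ α * ‖F y‖ * (1 + ∑ i, ∑ j ∈ Finset.univ.erase i, ‖y i - y j‖⁻¹) ^ β ≤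
      4 ^ α * (1 + (n : ℝ) ^ 2) ^ β * schwartzNorm (α + (β + 1)) F := by
  set S := schwartzNorm (α + (β + 1)) F with hS
  have hS0 : 0 ≤ S := schwartzNorm_nonneg _ _
  have hσ0 : 0 ≤ ∑ i, ∑ j ∈ Finset.univ.erase i, ‖y i - y j‖⁻¹ :=
    Finset.sum_nonneg fun i _ => Finset.sum_nonneg fun j _ => inv_nonneg.2 (norm_nonneg _)
  -- plain Schwartz decay
  have hdec : (1 + ‖y‖) ^ α * ‖F y‖ ≤ 4 ^ α * S := by
    have h := SchwartzMap.one_add_le_sup_seminorm_apply (𝕜 := ℂ) (m := (α, 0)) (k := α) (n := 0)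
      le_rfl le_rfl F y
    rw [norm_iteratedFDeriv_zero] at h
    refine h.trans (mul_le_mul (pow_le_pow_left₀ (by norm_num) (by norm_num) α)
      (sup_seminorm_le_schwartzNorm (by omega) (by omega) F) (apply_nonneg _ _) (by positivity))
  by_cases hsmall : ∀ i j : Fin n, i ≠ j → ‖y i - y j‖⁻¹ ≤ 1
  · have hσ : ∑ i, ∑ j ∈ Finset.univ.erase i, ‖y i - y j‖⁻¹ ≤ (n : ℝ) ^ 2 := by
      calc ∑ i, ∑ j ∈ Finset.univ.erase i, ‖y i - y j‖⁻¹
          ≤ ∑ i, ∑ j ∈ Finset.univ.erase i, (1 : ℝ) := Finset.sum_le_sum fun i _ =>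
            Finset.sum_le_sum fun j hj => hsmall i j (Finset.mem_erase.1 hj).1.symm
        _ ≤ ∑ _i : Fin n, ∑ _j : Fin n, (1 : ℝ) := Finset.sum_le_sum fun i _ =>
            Finset.sum_le_sum_of_subset_of_nonneg (Finset.erase_subset _ _) fun _ _ _ => zero_le_one
        _ = (n : ℝ) ^ 2 := by
            simp only [Finset.sum_const, Finset.card_univ, Fintype.card_fin, nsmul_eq_mul, mul_one]
            ring
    calc (1 + ‖y‖) ^ α * ‖F y‖ * (1 + ∑ i, ∑ j ∈ Finset.univ.erase i, ‖y i - y j‖⁻¹) ^ β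
        ≤ 4 ^ α * S * (1 + (n : ℝ) ^ 2) ^ β :=
          mul_le_mul hdec (pow_le_pow_left₀ (by positivity) (by linarith) β) (by positivity)
            (by positivity)
      _ = 4 ^ α * (1 + (n : ℝ) ^ 2) ^ β * S := by ring
  · push Not at hsmall
    obtain ⟨i₁, j₁, hij₁, hbig⟩ := hsmall
    obtain ⟨q, hq, hmax⟩ := Finset.exists_max_image
      (Finset.univ.filter fun q : Fin n × Fin n => q.1 ≠ q.2) (fun q => ‖y q.1 - y q.2‖⁻¹)
      ⟨(i₁, j₁), by simpa using hij₁⟩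
    have hq' : q.1 ≠ q.2 := by simpa using hq
    have hρ1 : 1 < ‖y q.1 - y q.2‖⁻¹ := hbig.trans_le (hmax (i₁, j₁) (by simpa using hij₁))
    have hρ0 : 0 < ‖y q.1 - y q.2‖⁻¹ := one_pos.trans hρ1
    have hδ0 : 0 < ‖y q.1 - y q.2‖ := inv_pos.1 hρ0
    have hδ1 : ‖y q.1 - y q.2‖ ≤ 1 := by
      have h := inv_le_one_of_one_le₀ hρ1.le
      rwa [inv_inv] at h
    -- the double sum is at most `n² ρ`
    have hσ : ∑ i, ∑ j ∈ Finset.univ.erase i, ‖y i - y j‖⁻¹ ≤ (n : ℝ) ^ 2 * ‖y q.1 - y q.2‖⁻¹ := by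
      calc ∑ i, ∑ j ∈ Finset.univ.erase i, ‖y i - y j‖⁻¹
          ≤ ∑ i, ∑ j ∈ Finset.univ.erase i, ‖y q.1 - y q.2‖⁻¹ := Finset.sum_le_sum fun i _ =>
            Finset.sum_le_sum fun j hj => hmax (i, j)
              (Finset.mem_filter.2 ⟨Finset.mem_univ _, (Finset.mem_erase.1 hj).1.symm⟩)
        _ ≤ ∑ _i : Fin n, ∑ _j : Fin n, ‖y q.1 - y q.2‖⁻¹ := Finset.sum_le_sum fun i _ =>
            Finset.sum_le_sum_of_subset_of_nonneg (Finset.erase_subset _ _) fun _ _ _ => hρ0.le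
        _ = (n : ℝ) ^ 2 * ‖y q.1 - y q.2‖⁻¹ := by
            simp only [Finset.sum_const, Finset.card_univ, Fintype.card_fin, nsmul_eq_mul]
            ring
    have hu : 1 + ∑ i, ∑ j ∈ Finset.univ.erase i, ‖y i - y j‖⁻¹ ≤
        (1 + (n : ℝ) ^ 2) * ‖y q.1 - y q.2‖⁻¹ := by
      have h := hρ1.le
      nlinarith
    -- weighted flatness at the coincident point `y` with `y_{q.1} ↦ y_{q.2}`
    have hflat : (1 + ‖y‖) ^ α * ‖F y‖ ≤ 4 ^ α * S * ‖y q.1 - y q.2‖ ^ (β + 1) := by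
      have h := hF.one_add_norm_pow_mul_norm_le_sub (a := q.2) (b := q.1) hq'.symm hδ1
        (k := α) (M := β) (m := α + (β + 1)) (by omega) (by omega)
      refine h.trans (div_le_self (by positivity) ?_)
      exact_mod_cast Nat.succ_le_of_lt (Nat.factorial_pos β)
    calc (1 + ‖y‖) ^ α * ‖F y‖ * (1 + ∑ i, ∑ j ∈ Finset.univ.erase i, ‖y i - y j‖⁻¹) ^ β
        ≤ 4 ^ α * S * ‖y q.1 - y q.2‖ ^ (β + 1) * ((1 + (n : ℝ) ^ 2) * ‖y q.1 - y q.2‖⁻¹) ^ β :=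
          mul_le_mul hflat (pow_le_pow_left₀ (by positivity) hu β) (by positivity) (by positivity)
      _ = 4 ^ α * (1 + (n : ℝ) ^ 2) ^ β * S *
            (‖y q.1 - y q.2‖ * (‖y q.1 - y q.2‖ * ‖y q.1 - y q.2‖⁻¹) ^ β) := by
          rw [mul_pow, mul_pow]; ring
      _ = 4 ^ α * (1 + (n : ℝ) ^ 2) ^ β * S * ‖y q.1 - y q.2‖ := by
          rw [mul_inv_cancel₀ hδ0.ne', one_pow, mul_one]
      _ ≤ 4 ^ α * (1 + (n : ℝ) ^ 2) ^ β * S := mul_le_of_le_one_right (by positivity) hδ1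

-- adapted from `DominatedTieLimit.norm_mul_weight_le` (same file), same change of constant.
/-- **Flat `⁰𝒮` functions against a tempered pair weight decay like a Japanese bracket.** If
`w y ≤ C (1 + ‖y‖)^N (1 + Σ_i Σ_{j ≠ i} ‖y_i - y_j‖⁻¹)^N` off the coincidence locus, then for every
`F ∈ ⁰𝒮(Eⁿ)`, every `M` and every `y`:
`‖F y‖ w y ≤ |C| 4^{N+M} (1 + n²)^N |F|_{N+M+N+1} · (1 + ‖y‖)^{-M}` (on the locus `F y = 0`).
[folklore] -/
theorem norm_mul_weight_le {F : 𝓢((Fin n → E), ℂ)} (hF : IsOffDiagonal F) {w : (Fin n → E) → ℝ}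
    {C : ℝ} {N : ℕ}
    (hwC : ∀ y ∉ coincidenceLocus n E,
      w y ≤ C * (1 + ‖y‖) ^ N * (1 + ∑ i, ∑ j ∈ Finset.univ.erase i, ‖y i - y j‖⁻¹) ^ N)
    (M : ℕ) (y : Fin n → E) :
    ‖F y‖ * w y ≤ |C| * 4 ^ (N + M) * (1 + (n : ℝ) ^ 2) ^ N *
      schwartzNorm (N + M + (N + 1)) F * ((1 + ‖y‖) ^ M)⁻¹ := by
  have hS0 : 0 ≤ schwartzNorm (N + M + (N + 1)) F := schwartzNorm_nonneg _ _
  by_cases hy : y ∈ coincidenceLocus n E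
  · rw [hF.apply_eq_zero hy, norm_zero, zero_mul]
    positivity
  · have hA := flat_decay_pairWeight hF (N + M) N y
    have hσ0 : 0 ≤ ∑ i, ∑ j ∈ Finset.univ.erase i, ‖y i - y j‖⁻¹ :=
      Finset.sum_nonneg fun i _ => Finset.sum_nonneg fun j _ => inv_nonneg.2 (norm_nonneg _)
    have hw : w y ≤ |C| * (1 + ‖y‖) ^ N * (1 + ∑ i, ∑ j ∈ Finset.univ.erase i, ‖y i - y j‖⁻¹) ^ N :=
      (hwC y hy).trans (by gcongr; exact le_abs_self C)
    have hpos : 0 < (1 + ‖y‖) ^ M := by positivity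
    rw [← div_eq_mul_inv, le_div_iff₀ hpos]
    calc ‖F y‖ * w y * (1 + ‖y‖) ^ M
        ≤ ‖F y‖ * (|C| * (1 + ‖y‖) ^ N *
            (1 + ∑ i, ∑ j ∈ Finset.univ.erase i, ‖y i - y j‖⁻¹) ^ N) * (1 + ‖y‖) ^ M := by
          gcongr
      _ = |C| * ((1 + ‖y‖) ^ (N + M) * ‖F y‖ *
            (1 + ∑ i, ∑ j ∈ Finset.univ.erase i, ‖y i - y j‖⁻¹) ^ N) := by
          rw [pow_add]; ring
      _ ≤ |C| * (4 ^ (N + M) * (1 + (n : ℝ) ^ 2) ^ N * schwartzNorm (N + M + (N + 1)) F) :=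
          mul_le_mul_of_nonneg_left hA (abs_nonneg C)
      _ = _ := by ring

end Flat

/-! ## The weighted `L²` embedding of `⁰𝒮((ℝ⁴)ⁿ)` -/

variable {n : ℕ}

/-- The inverse Japanese bracket `(1 + ‖y‖)^{-(2n+1)}` is square integrable on `(ℝ⁴)ⁿ`
(`2(2n+1) > 4n = dim`). [folklore] -/
theorem memLp_two_invBracket (n : ℕ) :
    MemLp (fun y : Fin n → E4 => ((1 + ‖y‖) ^ (2 * n + 1))⁻¹) 2 (volume : Measure (Fin n → E4)) := by
  rw [memLp_two_iff_integrable_sq (by fun_prop)]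
  refine (DominatedTieLimit.integrable_piMajorant (n := n) (p := 2 * (2 * n + 1)) (by omega) 1).congr
    (ae_of_all _ fun y => ?_)
  simp only
  rw [one_mul, pow_mul', inv_pow]

/-- **`φ_F = w (1 + ‖·‖)^{2n+1} F ∈ L²((ℝ⁴)ⁿ)` for `F ∈ ⁰𝒮`** and a measurable weight `w ≥ 0`
tempered off the coincidence locus: by the flat decay against the pair weight,
`‖φ_F(y)‖ ≤ K_F (1 + ‖y‖)^{-(2n+1)}`, which is square integrable. [folklore] -/
theorem memLp_two_weighted {w : (Fin n → E4) → ℝ} {C : ℝ} {N : ℕ} (hwm : Measurable w)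
    (hw0 : ∀ y, 0 ≤ w y)
    (hwC : ∀ y ∉ coincidenceLocus n E4,
      w y ≤ C * (1 + ‖y‖) ^ N * (1 + ∑ i, ∑ j ∈ Finset.univ.erase i, ‖y i - y j‖⁻¹) ^ N)
    {F : 𝓢((Fin n → E4), ℂ)} (hF : IsOffDiagonal F) :
    MemLp (fun y : Fin n → E4 => ((w y * (1 + ‖y‖) ^ (2 * n + 1) : ℝ) : ℂ) * F y) 2
      (volume : Measure (Fin n → E4)) := by
  set K₀ : ℝ := |C| * 4 ^ (N + (2 * n + 1 + (2 * n + 1))) * (1 + (n : ℝ) ^ 2) ^ N *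
    schwartzNorm (N + (2 * n + 1 + (2 * n + 1)) + (N + 1)) F with hK₀
  -- comparison with the square-integrable majorant `K₀ (1 + ‖y‖)^{-(2n+1)}`
  refine ((memLp_two_invBracket n).const_mul K₀).mono' (by fun_prop) (ae_of_all _ fun y => ?_)
  have h := norm_mul_weight_le hF hwC (2 * n + 1 + (2 * n + 1)) y
  rw [← hK₀] at h
  rw [norm_mul, Complex.norm_real, Real.norm_of_nonneg (mul_nonneg (hw0 y) (by positivity))]
  have hpos : 0 < (1 + ‖y‖) ^ (2 * n + 1) := by positivity
  calc w y * (1 + ‖y‖) ^ (2 * n + 1) * ‖F y‖ = (1 + ‖y‖) ^ (2 * n + 1) * (‖F y‖ * w y) := by ring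
    _ ≤ (1 + ‖y‖) ^ (2 * n + 1) * (K₀ * ((1 + ‖y‖) ^ (2 * n + 1 + (2 * n + 1)))⁻¹) :=
        mul_le_mul_of_nonneg_left h hpos.le
    _ = K₀ * ((1 + ‖y‖) ^ (2 * n + 1))⁻¹ := by
        rw [pow_add _ (2 * n + 1) (2 * n + 1), mul_inv, mul_left_comm, mul_inv_cancel_left₀ hpos.ne']

/-- **Cauchy–Schwarz against the inverse bracket**: for `w ≥ 0` and `φ_F = w (1 + ‖·‖)^{2n+1} F ∈ L²`,
`∫ ‖F‖ w ≤ ‖φ_F‖₂ · ‖(1 + ‖·‖)^{-(2n+1)}‖₂`. [folklore] -/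
theorem integral_norm_mul_weight_le {w : (Fin n → E4) → ℝ} (hw0 : ∀ y, 0 ≤ w y)
    {F : 𝓢((Fin n → E4), ℂ)}
    (hφ : MemLp (fun y : Fin n → E4 => ((w y * (1 + ‖y‖) ^ (2 * n + 1) : ℝ) : ℂ) * F y) 2
      (volume : Measure (Fin n → E4))) :
    ∫ y : Fin n → E4, ‖F y‖ * w y ≤ ‖hφ.toLp _‖ * ‖(memLp_two_invBracket n).toLp _‖ := by
  have ha : MemLp (fun y : Fin n → E4 => ‖((w y * (1 + ‖y‖) ^ (2 * n + 1) : ℝ) : ℂ) * F y‖) 2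
      (volume : Measure (Fin n → E4)) := hφ.norm
  have hab : ⟪ha.toLp _, (memLp_two_invBracket n).toLp _⟫_ℝ = ∫ y : Fin n → E4, ‖F y‖ * w y := by
    rw [MeasureTheory.L2.inner_def]
    refine integral_congr_ae ?_
    filter_upwards [ha.coeFn_toLp, (memLp_two_invBracket n).coeFn_toLp] with y hay hby
    rw [hay, hby, Real.inner_apply, norm_mul, Complex.norm_real,
      Real.norm_of_nonneg (mul_nonneg (hw0 y) (by positivity))]
    have hpos : 0 < (1 + ‖y‖) ^ (2 * n + 1) := by positivity
    field_simp
  have hna : ‖ha.toLp _‖ = ‖hφ.toLp _‖ := by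
    rw [Lp.norm_toLp, Lp.norm_toLp, eLpNorm_norm]
  rw [← hab, ← hna]
  exact real_inner_le_norm _ _

end RegularOfDominated

/-! ## The registered stub -/

/-- **Stub 1c — AN `L¹(w)`-DOMINATED FUNCTIONAL ON `⁰𝒮` IS A FUNCTION (model-blind analysis; registered
signature of reshape 8 of the skeleton `Cruxes/CurvatureBoostCovariance/Lines/boosts_inherit_mirrors.lean`,
verbatim).**  If `‖T F‖ ≤ ∫ ‖F‖ w` on `⁰𝒮` for a measurable weight `w ≥ 0` tempered off the coincidence
locus, then `T F = ∫ W · F` on `⁰𝒮` with `W · F ∈ L¹`, for some `W : (ℝ⁴)ⁿ → ℂ`.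
Proof: `F ↦ φ_F = w (1 + ‖·‖)^{2n+1} F` maps `⁰𝒮` linearly into `L²`, Cauchy–Schwarz gives
`‖T F‖ ≤ K ‖φ_F‖₂`, so `T|⁰𝒮` is represented by a vector `ξ ∈ L²` (Hahn–Banach + Riesz), and
`W = conj ξ · w (1 + ‖·‖)^{2n+1}`. [folklore] -/
theorem stub_regular_of_dominated :
    open Literature.MathematicalPhysics.QuantumLattice Literature.MathematicalPhysics.AQFT
      Summit.QuantumFields.YangMills.Theorems.NPointIsotropy.Negative in
    ∀ (n : ℕ) (T : SchwartzMap (Fin n → E4) ℂ →L[ℂ] ℂ) (w : (Fin n → E4) → ℝ) (C : ℝ) (N : ℕ),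
      Measurable w → (∀ y, 0 ≤ w y) →
      (∀ y ∉ coincidenceLocus n E4,
        w y ≤ C * (1 + ‖y‖) ^ N * (1 + ∑ i, ∑ j ∈ Finset.univ.erase i, ‖y i - y j‖⁻¹) ^ N) →
      (∀ F : SchwartzMap (Fin n → E4) ℂ, IsOffDiagonal F →
        MeasureTheory.Integrable (fun y : Fin n → E4 => ‖F y‖ * w y) ∧
          ‖T F‖ ≤ ∫ y : Fin n → E4, ‖F y‖ * w y) →
      ∃ W : (Fin n → E4) → ℂ, ∀ F : SchwartzMap (Fin n → E4) ℂ, IsOffDiagonal F →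
        MeasureTheory.Integrable (fun y : Fin n → E4 => W y * F y) ∧ T F = ∫ y : Fin n → E4, W y * F y := by
  intro n T w C N hwm hw0 hwC hdom
  -- the `ℂ`-subspace `⁰𝒮`
  let S : Submodule ℂ 𝓢((Fin n → E4), ℂ) :=
    { carrier := {F | IsOffDiagonal F}
      add_mem' := fun hF hG => hF.add hG
      zero_mem' := isOffDiagonal_zero
      smul_mem' := fun c _ hF => hF.smul c }
  -- the weighted functions `φ_F` and their membership in `L²`
  let φ : 𝓢((Fin n → E4), ℂ) → (Fin n → E4) → ℂ := fun F y =>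
    ((w y * (1 + ‖y‖) ^ (2 * n + 1) : ℝ) : ℂ) * F y
  have hmem : ∀ F : S, MemLp (φ F) 2 (volume : Measure (Fin n → E4)) := fun F =>
    RegularOfDominated.memLp_two_weighted hwm hw0 hwC F.2
  -- the linear map `J : ⁰𝒮 → L²`
  let J : S →ₗ[ℂ] Lp ℂ 2 (volume : Measure (Fin n → E4)) :=
    { toFun := fun F => (hmem F).toLp (φ F)
      map_add' := fun F G => by
        rw [← MemLp.toLp_add]
        exact MemLp.toLp_congr _ _ (Eventually.of_forall fun y => by
          simp only [φ, Pi.add_apply, Submodule.coe_add, add_apply]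
          ring)
      map_smul' := fun c F => by
        rw [RingHom.id_apply, ← MemLp.toLp_const_smul]
        exact MemLp.toLp_congr _ _ (Eventually.of_forall fun y => by
          simp only [φ, Pi.smul_apply, Submodule.coe_smul, smul_apply, smul_eq_mul]
          ring) }
  have hJ : ∀ F : S, J F = (hmem F).toLp (φ F) := fun F => rfl
  -- domination by the `L²` norm
  set K : ℝ := ‖(RegularOfDominated.memLp_two_invBracket n).toLp _‖ with hK
  have hbound : ∀ F : S, ‖(T.toLinearMap ∘ₗ S.subtype) F‖ ≤ K * ‖J F‖ := by
    intro F
    rw [LinearMap.comp_apply, Submodule.subtype_apply, ContinuousLinearMap.coe_coe, hJ, mul_comm]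
    exact (hdom F F.2).2.trans (RegularOfDominated.integral_norm_mul_weight_le hw0 (hmem F))
  -- the representing vector
  obtain ⟨ξ, hξ⟩ := RegularOfDominated.exists_inner_repr_of_norm_le _ J K hbound
  refine ⟨fun y => conj (ξ y) * ((w y * (1 + ‖y‖) ^ (2 * n + 1) : ℝ) : ℂ), fun F hF => ?_⟩
  have hae : (fun y => ⟪ξ y, (J ⟨F, hF⟩ : Lp ℂ 2 (volume : Measure (Fin n → E4))) y⟫_ℂ) =ᵐ[volume]
      fun y => conj (ξ y) * ((w y * (1 + ‖y‖) ^ (2 * n + 1) : ℝ) : ℂ) * F y := by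
    filter_upwards [(hmem ⟨F, hF⟩).coeFn_toLp] with y hy
    rw [hJ, hy, RCLike.inner_apply']
    simp only [φ]
    ring
  refine ⟨(L2.integrable_inner (𝕜 := ℂ) ξ (J ⟨F, hF⟩)).congr hae, ?_⟩
  have h := hξ ⟨F, hF⟩
  rw [LinearMap.comp_apply, Submodule.subtype_apply, ContinuousLinearMap.coe_coe] at h
  rw [h, L2.inner_def]
  exact integral_congr_ae hae

end Summit.QuantumFields.YangMills.Theorems.CurvatureBoostCovariance.BoostsInheritMirrors

end
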